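import Summits.ResolutionOfSingularities.ResolutionOfSingularities.Theorems.IndSmoothValuativeSmoothingRelLUCompositeStep
import Summits.ResolutionOfSingularities.ResolutionOfSingularities.Theorems.IndSmoothValuativeSmoothingRelLUOfResidueTrdegLeOne
import Summits.ResolutionOfSingularities.ResolutionOfSingularities.Theorems.IndSmoothValuativeSmoothingOfRelLU
import Summits.ResolutionOfSingularities.ResolutionOfSingularities.Theorems.IndSmoothValuativeSmoothingRelLURegularCentre
import Literature.AlgebraicGeometry.Resolution.LocalUniformizationAbhyankarPlaces
import HarnessLib

/-!
# The eighth proved family of the crux `ValuativeSmoothing`: composites under a uniformizable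
# coarsening whose residue field has transcendence degree `≤ 1` (finitely generated or not)

Support file for crux stmt-ResolutionOfSingularities-16087 (`ValuativeSmoothing`, route file
`Theses/IndSmooth.lean`), line `birth`, lead seat c3 (reshape r8, case `hC8` of the
composition). For fields `k ⊆ K` and valuation rings `O ≤ O₁` of `K` containing `k`
(`ν_O = ν₁ ∘ ν₂`), SUPPOSE

* `O₁` admits relative local uniformization over `k` (`RelLocalUniformization k K O₁`;
  e.g. `O₁` an Abhyankar place over a perfect `k` — Knaf–Kuhlmann — or `O₁` centred at a
  regular point of dimension `≤ 2` of some affine model — `relLU_of_regularCentre`, p169817);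
* the residue field `κ(O₁)` has transcendence degree `≤ 1` over `k`, said inside `K`: any two
  elements of `O₁` satisfy a non-zero polynomial relation over `k` modulo `𝔪_{O₁}` (`htr`).

THEN `O` admits relative local uniformization over `k`
(`relLU_of_le_of_relLU_of_residueTrdegLeOne`), hence — `k` perfect, `K/k` finitely
generated — the crux holds at `O` (`smoothFactor_of_le_of_relLU_of_residueTrdegLeOne`).
Mechanism: Novacoski–Spivakovsky's composite step for the one pair `(O, O₁)` in its general
form (`stub_relLUCompositeStep`, p173146: the residue input is asked for the restriction of
`ν₂` to EVERY field `κ` mapping `k`-compatibly into `κ(O₁)`; no generation hypothesis on the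
residue field), fed with local uniformization in dimension one (`stub_relLUOfResidueTrdegLeOne`,
p173184: such a `κ` has `trdeg_k κ ≤ 1`, and the tree PROVES `RelLocalUniformization` for all
valuation rings of all such `κ` — resolution of curves by normalization,
`relLocalUniformization_of_trdeg_le_one`).

What is NEW compared with the composite families 6/6' of lead c2
(`smoothFactor_of_le_of_purelyTranscendentalResidue` p170234,
`smoothFactor_of_le_of_regularCentreResidue` p170915): those need the residue field of `O₁`
to be finitely generated over `k` by residues of finitely many elements of `O` (hypothesis
`hres`). Here it may be ANY extension of transcendence degree `≤ 1`. Example inside the r7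
open core (zero-dimensional, non-Abhyankar, a non-discrete jump, no regular centre of dimension
`≤ 2`): on `K = k(x,y,z)` let `O₁` be the discrete rank-one valuation ring of the formal arc
`y = u`, `z = Σ_{i ≥ 0} u^{1/pⁱ} xⁱ` (`K ⊂ k(u^{1/p^∞})((x))`); its centre on `k[x,y,z]` is the
prime `(x, z - y)`, a regular point of dimension `2`, so `RelLU(O₁)` holds by
`relLU_of_regularCentre`, while its residue field is the perfect closure `k(u)^{perf}` —
transcendence degree `1`, NOT finitely generated (the residues of `(z-y)/x`, … are
`u^{1/p}, u^{1/p²}, …`). Composing with the `ū`-adic valuation of `k(u)^{perf}` (value group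
`ℤ[1/p]`) gives `O < O₁` with value group `ℤ ×ₗₑₓ ℤ[1/p]`, residue field `k`: the crux holds
there by `smoothFactor_of_le_regularCentre_of_residueTrdegLeOne` below, and no earlier family
applies.

## Sources

J. Novacoski, M. Spivakovsky, *Reduction of local uniformization to the rank one case*,
Valuation Theory in Interaction, EMS Ser. Congr. Rep. (2014) 404–431 = arXiv:1204.4751v1,
Cor. 2.14, Cor. 2.17, §3.1 [NovacoskiSpivakovsky2014]. H. Knaf, F.-V. Kuhlmann, *Abhyankar
places admit local uniformization in any characteristic*, Ann. Sci. ÉNS 38 (2005) 833–846,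
Thm. 1.1 [KnafKuhlmann2005]. S. Abhyankar, *On the valuations centered in a local domain*,
Amer. J. Math. 78 (1956), Lemma 12 [Abhyankar1956Valuations].
-/

-- single-problem summit: the doubled namespace component is forced
set_option linter.dupNamespace false

namespace Summit.ResolutionOfSingularities.ResolutionOfSingularities.Theorems.ValuativeSmoothing

open IsLocalRing Literature.AlgebraicGeometry.Resolution

/-- **Family 8, local-uniformization form.** For valuation rings `O ≤ O₁` of `K` over `k`
with `RelLocalUniformization k K O₁` and residue field of `O₁` of transcendence degree `≤ 1`
over `k` (any two elements of `O₁` satisfy a non-zero polynomial relation over `k` modulo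
`𝔪_{O₁}`), `RelLocalUniformization k K O` holds: the general composite step
(`stub_relLUCompositeStep`) with the residue input supplied by local uniformization of curves
(`stub_relLUOfResidueTrdegLeOne`). No hypothesis on `k`, none on finite generation of the
residue field. [cite: NovacoskiSpivakovsky2014, Cor. 2.14, Cor. 2.17 and §3.1] -/
theorem relLU_of_le_of_relLU_of_residueTrdegLeOne (k K : Type) [Field k] [Field K] [Algebra k K]
    (O O₁ : ValuationSubring K) (hO : O ≤ O₁) (hk : ∀ c : k, algebraMap k K c ∈ O₁)
    (h₁ : RelLocalUniformization k K O₁)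
    (htr : ∀ x y : K, x ∈ O₁ → y ∈ O₁ → ∃ f : MvPolynomial (Fin 2) k, f ≠ 0 ∧
      O₁.valuation (MvPolynomial.aeval ![x, y] f) < 1) :
    RelLocalUniformization k K O :=
  stub_relLUCompositeStep k K O O₁ hO hk h₁
    (fun κ _ _ ι hι => stub_relLUOfResidueTrdegLeOne k K O O₁ hO hk htr κ ι hι)

/-- **Family 8 of the crux `ValuativeSmoothing`** (`k` perfect, any characteristic, `K/k`
finitely generated): if `O ≤ O₁` are valuation rings of `K` containing `k` such that `O₁`
admits relative local uniformization over `k` and the residue field of `O₁` has transcendence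
degree `≤ 1` over `k` (finitely generated OR NOT), then every finitely generated `R ⊆ O`
factors `R → T → O ⊆ K` through a smooth `k`-algebra `T` — the conclusion of the crux at `O`
(`relLU_of_le_of_relLU_of_residueTrdegLeOne` and the landed transfer
`smoothFactor_of_relLocalUniformization`, p169280).
[cite: NovacoskiSpivakovsky2014, Cor. 2.14, Cor. 2.17 and §3.1] -/
theorem smoothFactor_of_le_of_relLU_of_residueTrdegLeOne (k K : Type) [Field k] [PerfectField k]
    [Field K] [Algebra k K] (hK : (⊤ : IntermediateField k K).FG)
    (O O₁ : ValuationSubring K) (hO : O ≤ O₁) (hOk : ∀ c : k, algebraMap k K c ∈ O)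
    (h₁ : RelLocalUniformization k K O₁)
    (htr : ∀ x y : K, x ∈ O₁ → y ∈ O₁ → ∃ f : MvPolynomial (Fin 2) k, f ≠ 0 ∧
      O₁.valuation (MvPolynomial.aeval ![x, y] f) < 1)
    (R : Subalgebra k K) (hR : R.FG) (hRO : R.toSubring ≤ O.toSubring) :
    ∃ (T : Type) (_ : CommRing T) (_ : Algebra k T), Algebra.Smooth k T ∧
      ∃ (ψ : R →ₐ[k] T) (χ : T →ₐ[k] K), (∀ t : T, χ t ∈ O) ∧ ∀ r : R, χ (ψ r) = (r : K) :=
  smoothFactor_of_relLocalUniformization k K hK O hOk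
    (relLU_of_le_of_relLU_of_residueTrdegLeOne k K O O₁ hO (fun c => hO (hOk c)) h₁ htr) R hR hRO

/-- **Family 8, the coarsening centred at a regular point of dimension `≤ 2`** (the shape of
the example in the module docstring): `O ≤ O₁ ⊆ K` over a perfect `k`, `K/k` finitely
generated, `B ⊆ O₁` a finitely generated `k`-subalgebra with `Frac B = K` whose local ring at
the centre of `O₁` is regular of dimension `≤ 2` (so `RelLU(O₁)` by `relLU_of_regularCentre`,
Abhyankar's Lemma 12), and the residue field of `O₁` of transcendence degree `≤ 1` over `k`
⇒ the crux holds at `O`. [cite: Abhyankar1956Valuations, Lemma 12] -/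
theorem smoothFactor_of_le_regularCentre_of_residueTrdegLeOne (k K : Type) [Field k]
    [PerfectField k] [Field K] [Algebra k K] (hK : (⊤ : IntermediateField k K).FG)
    (O O₁ : ValuationSubring K) (hO : O ≤ O₁) (hOk : ∀ c : k, algebraMap k K c ∈ O)
    (B : Subalgebra k K) (hBfg : B.FG) (hBO₁ : B.toSubring ≤ O₁.toSubring)
    (hfrac : ∀ z : K, ∃ a ∈ B, ∃ b ∈ B, b ≠ 0 ∧ z = a / b)
    (hreg : IsRegularLocalRing (locAtCentre B.toSubring O₁))
    (hdim : ringKrullDim (locAtCentre B.toSubring O₁) ≤ 2)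
    (htr : ∀ x y : K, x ∈ O₁ → y ∈ O₁ → ∃ f : MvPolynomial (Fin 2) k, f ≠ 0 ∧
      O₁.valuation (MvPolynomial.aeval ![x, y] f) < 1)
    (R : Subalgebra k K) (hR : R.FG) (hRO : R.toSubring ≤ O.toSubring) :
    ∃ (T : Type) (_ : CommRing T) (_ : Algebra k T), Algebra.Smooth k T ∧
      ∃ (ψ : R →ₐ[k] T) (χ : T →ₐ[k] K), (∀ t : T, χ t ∈ O) ∧ ∀ r : R, χ (ψ r) = (r : K) :=
  smoothFactor_of_le_of_relLU_of_residueTrdegLeOne k K hK O O₁ hO hOk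
    (relLU_of_regularCentre k K O₁ B hBfg hBO₁ hfrac hreg hdim) htr R hR hRO

/-- **Family 8, the coarsening an Abhyankar place** (Knaf–Kuhlmann 2005 over a perfect ground
field supplies `RelLU(O₁)`): `O ≤ O₁ ⊆ K`, `k` perfect, `K/k` finitely generated, `O₁` an
Abhyankar place of `K | k` with residue field of transcendence degree `≤ 1` over `k` (e.g. a
prime divisor of a surface, or a rank-one valuation of rational rank `trdeg K - 1` with
residually transcendental element) ⇒ the crux holds at every `O ≤ O₁`.
[cite: KnafKuhlmann2005, Thm. 1.1 and Cor. 2.2] -/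
theorem smoothFactor_of_le_abhyankarPlace_of_residueTrdegLeOne (k K : Type) [Field k]
    [PerfectField k] [Field K] [Algebra k K] (hK : (⊤ : IntermediateField k K).FG)
    (O O₁ : ValuationSubring K) (hO : O ≤ O₁) (hOk : ∀ c : k, algebraMap k K c ∈ O)
    (hAbh : IsAbhyankarPlace O₁ (algebraMap k K).fieldRange ⊤)
    (htr : ∀ x y : K, x ∈ O₁ → y ∈ O₁ → ∃ f : MvPolynomial (Fin 2) k, f ≠ 0 ∧
      O₁.valuation (MvPolynomial.aeval ![x, y] f) < 1)
    (R : Subalgebra k K) (hR : R.FG) (hRO : R.toSubring ≤ O.toSubring) :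
    ∃ (T : Type) (_ : CommRing T) (_ : Algebra k T), Algebra.Smooth k T ∧
      ∃ (ψ : R →ₐ[k] T) (χ : T →ₐ[k] K), (∀ t : T, χ t ∈ O) ∧ ∀ r : R, χ (ψ r) = (r : K) := by
  have hO₁k : ∀ c : k, algebraMap k K c ∈ O₁ := fun c => hO (hOk c)
  have h₁ : RelLocalUniformization k K O₁ := by
    intro R' hR' _ hR'O
    obtain ⟨A, h, hRA, hAfg, -, hreg⟩ :=
      relLU_at_abhyankarPlace_of_perfectField hK O₁ hO₁k hAbh R' hR' hR'O
    exact ⟨A, h, hRA, hAfg, hreg⟩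
  exact smoothFactor_of_le_of_relLU_of_residueTrdegLeOne k K hK O O₁ hO hOk h₁ htr R hR hRO

end Summit.ResolutionOfSingularities.ResolutionOfSingularities.Theorems.ValuativeSmoothing
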